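/-
Copyright: public-audit package `pub-balaban` (b2b-balaban), seat pv09-g4. Released under Apache 2.0 like Mathlib.
-/
import Literature.MathematicalPhysics.QuantumFieldTheory.Balaban1983to89.B6LayerUpperBound

/-!
# B6, p. 245: the layer obstruction in Rayleigh-quotient form; the printed factor 1 fails for EVERY L ≥ 10

Source under audit: T. Bałaban, *Propagators and renormalization transformations for lattice gauge theories.
II*, Commun. Math. Phys. **96** (1984) 223–250 [B6], proof of Lemma 2.4, p. 245.  Companion of
`B6LayerUpperBound` (κ ≤ 12/(L + 1)), `B6Lemma24Kappa` (`LayerIneq d L κ`) and of the one-dimensional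
`decide` witness `B6.witnessL10` / `B6.claim_p245_fails_L10` of `B6.lean`.

## The printed sentence (verbatim, p. 245, between (2.126) and (2.127))

*"The terms in parentheses on the right-hand side can be written as L^{−2}⟨B, (Δ_{Δ′}^{L^{−1},N} +
Q′*_{Δ′}Q′_{Δ′})B⟩, where the operators are defined on a d − 1-dimensional lattice.  This quadratic form is
bounded from below by L^{−d−1} Σ_{x∈Δ′} |B_μ(x)|², hence"* [(2.127) follows].  (Same quotation as in
`B6LayerPoincare` and `B6LayerUpperBound`.)  The sentence is the layer inequality `LayerIneq d L 1`.

## What this file proves (all [folklore]; nothing printed is asserted or used)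

* `layerIneq_rayleigh` — for every d ≥ 2, L ≥ 1, every real κ and EVERY profile u : ℤ → ℝ with
  Σ_{0≤a<L} u(a) = 0:  `LayerIneq d L κ → κ · Σ_{0≤a<L} u(a)² ≤ L · Σ_{0≤a<L−1} (u(a+1) − u(a))²`
  (test function g(x) = u(x_ν) on the face Δ′ = {L − 1} × [0, L)^{d−1}; `sum_lastLayer_coord` of
  `B6LayerUpperBound` and `gradSq_profile` below).  So every admissible layer constant is at most L times the
  Rayleigh quotient of the path P_L at any mean-zero profile: the layer problem IS the one-dimensional Neumann
  problem, in every dimension.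
* `not_layerIneq_one_of_witness` — an INTEGER profile w with Σ w = 0 and L·Σ(w(i+1) − w(i))² < Σ w(i)² (two
  `decide` facts) refutes `LayerIneq d L 1` for all d ≥ 2.
* `not_layerIneq_one_ten` — instantiated with `B6.witnessL10` ITSELF: the one-dimensional `decide` fact
  `B6.claim_p245_fails_L10` (10 · 489500 < 5000652) now refutes the printed sentence `LayerIneq d 10 1` in every
  dimension d ≥ 2 (so far it was an isolated numerical statement about a list of ten integers).
* `not_layerIneq_one_eleven` — the analogous witness for L = 11 (1000·cos((i+½)π/11) rounded; 11 · 445892 =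
  4904812 < 5503882).
* `not_layerIneq_one_of_ten_le` — together with `B6LayerUpperBound.not_layerIneq_one` (L ≥ 12):
  **`2 ≤ d → 10 ≤ L → ¬ LayerIneq d L 1`** — the census claim G-B6-09 ("the printed factor 1 fails for L ≥ 10")
  kernel-certified in full; `not_layerIneq_of_one_le` extends it to every κ ≥ 1 (`LayerIneq.mono`).

## HONEST SCOPE

The positive half of the census statement — the printed factor 1 HOLDS for 2 ≤ L ≤ 9 (because 4L sin²(π/2L) ≥ 1
there) — needs the sharp Neumann–Poincaré inequality on P_L and is NOT formalised (the kernel has the weaker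
admissible constants κ₀, κ₁ < 1 only).  Nothing here concerns the constant of Lemma 2.4 (2.128) itself (printed
1/(12d²): numerically supported, unproved, G-B6-09R); the file certifies that the printed DERIVATION through the
layer sentence fails for every L ≥ 10 and every d ≥ 2.
-/

namespace Literature.MathematicalPhysics.QuantumFieldTheory.Balaban1983to89.B6LayerRayleigh

open Finset
open B6Elimination (block mem_block)
open B6BondElimination (unitVec unitVec_apply add_unitVec_apply)
open B6FaceInterpolation (lastLayer bondsIn mem_lastLayer mem_bondsIn)
open B6LayerPoincare (gradSq)
open B6Lemma24Kappa (LayerIneq)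
open B6LayerUpperBound (sum_Ico_int_eq_sum_range sum_lastLayer_coord add_unitVec_mem_lastLayer_iff
  not_layerIneq_one)

variable {d : ℕ} {L : ℕ}

/-! ## §1  Profile test functions g(x) = u(x_ν) on the face -/

/-- The profile test function g(x) = u(x_ν). [folklore] -/
def faceProfile (u : ℤ → ℝ) (ν : Fin d) (x : Fin d → ℤ) : ℝ := u (x ν)

/-- Σ_{Δ′} u(x_ν) = L^{d−2} Σ_{0≤a<L} u(a). [folklore] -/
theorem sum_profile (hL : 1 ≤ L) {μ ν : Fin d} (hμν : ν ≠ μ) (u : ℤ → ℝ) :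
    ∑ x ∈ lastLayer L (0 : Fin d → ℤ) μ, faceProfile u ν x = (L : ℝ) ^ (d - 2) * ∑ a ∈ Ico (0 : ℤ) L, u a :=
  sum_lastLayer_coord hL hμν u

/-- Σ_{Δ′} u(x_ν)² = L^{d−2} Σ_{0≤a<L} u(a)². [folklore] -/
theorem sum_profile_sq (hL : 1 ≤ L) {μ ν : Fin d} (hμν : ν ≠ μ) (u : ℤ → ℝ) :
    ∑ x ∈ lastLayer L (0 : Fin d → ℤ) μ, faceProfile u ν x ^ 2 =
      (L : ℝ) ^ (d - 2) * ∑ a ∈ Ico (0 : ℤ) L, u a ^ 2 :=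
  sum_lastLayer_coord hL hμν (fun a => u a ^ 2)

/-- The gradient form of a profile: only e_ν-bonds inside Δ′ contribute, each line [0, L) of Δ′ contributes the
path energy Σ_{a+1<L}(u(a+1) − u(a))², and there are L^{d−2} lines. [folklore] -/
theorem gradSq_profile (hL : 1 ≤ L) {μ ν : Fin d} (hμν : ν ≠ μ) (u : ℤ → ℝ) :
    gradSq (faceProfile u ν) (lastLayer L (0 : Fin d → ℤ) μ) =
      (L : ℝ) ^ (d - 2) * ∑ a ∈ Ico (0 : ℤ) L, (if a + 1 < (L : ℤ) then (u (a + 1) - u a) ^ 2 else 0) := by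
  classical
  set Δ := lastLayer L (0 : Fin d → ℤ) μ with hΔ
  set w : (Fin d → ℤ) → ℝ := fun x => (u (x ν + 1) - u (x ν)) ^ 2 with hw
  -- the summand vanishes off the direction ν and equals w(b₋) on it
  have h1 : gradSq (faceProfile u ν) Δ = ∑ b ∈ bondsIn Δ, (if b.2 = ν then w b.1 else 0) := by
    unfold gradSq
    refine sum_congr rfl fun b _ => ?_
    simp only [faceProfile, add_unitVec_apply, hw]
    by_cases hb : b.2 = ν
    · rw [if_pos hb, if_pos hb.symm]
    · rw [if_neg hb, if_neg (Ne.symm hb), add_zero, sub_self]; ring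
  -- re-index the ν-bonds by their starting points
  have h2 : ∑ b ∈ bondsIn Δ, (if b.2 = ν then w b.1 else 0) =
      ∑ x ∈ Δ.filter (fun x => x + unitVec ν ∈ Δ), w x := by
    rw [← sum_filter]
    refine sum_nbij' (fun b => b.1) (fun x => (x, ν)) ?_ ?_ ?_ ?_ ?_
    · intro b hb
      rw [mem_filter, mem_bondsIn] at hb
      rw [mem_filter]
      obtain ⟨⟨h1b, h2b⟩, h3b⟩ := hb
      rw [h3b] at h2b
      exact ⟨h1b, h2b⟩
    · intro x hx
      rw [mem_filter] at hx
      rw [mem_filter, mem_bondsIn]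
      exact ⟨⟨hx.1, hx.2⟩, rfl⟩
    · intro b hb
      rw [mem_filter] at hb
      exact Prod.ext rfl hb.2.symm
    · intro x _; rfl
    · intro b _; rfl
  have h3 : ∑ x ∈ Δ.filter (fun x => x + unitVec ν ∈ Δ), w x =
      ∑ x ∈ Δ, (if x ν + 1 < (L : ℤ) then w x else 0) := by
    rw [sum_filter]
    refine sum_congr rfl fun x hx => ?_
    by_cases h : x ν + 1 < (L : ℤ)
    · rw [if_pos h, if_pos ((add_unitVec_mem_lastLayer_iff hμν hx).2 h)]
    · rw [if_neg h, if_neg (fun h' => h ((add_unitVec_mem_lastLayer_iff hμν hx).1 h'))]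
  rw [h1, h2, h3, hΔ, sum_lastLayer_coord hL hμν (fun a => if a + 1 < (L : ℤ) then (u (a + 1) - u a) ^ 2 else 0)]

/-! ## §2  The Rayleigh-quotient bound -/

/-- **The layer problem is the one-dimensional Neumann problem.**  For d ≥ 2, L ≥ 1 and any mean-zero profile
u on [0, L):  `LayerIneq d L κ → κ · Σ u(a)² ≤ L · Σ_{a+1<L} (u(a+1) − u(a))²`. [folklore] -/
theorem layerIneq_rayleigh (hd : 2 ≤ d) (hL : 1 ≤ L) (u : ℤ → ℝ) (hu : ∑ a ∈ Ico (0 : ℤ) L, u a = 0)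
    {κ : ℝ} (h : LayerIneq d L κ) :
    κ * ∑ a ∈ Ico (0 : ℤ) L, u a ^ 2 ≤
      (L : ℝ) * ∑ a ∈ Ico (0 : ℤ) L, (if a + 1 < (L : ℤ) then (u (a + 1) - u a) ^ 2 else 0) := by
  obtain ⟨k, rfl⟩ : ∃ k, d = k + 2 := ⟨d - 2, by omega⟩
  set μ : Fin (k + 2) := ⟨0, by omega⟩ with hμ
  set ν : Fin (k + 2) := ⟨1, by omega⟩ with hν
  have hμν : ν ≠ μ := by
    intro e; have := congrArg Fin.val e; simp [hμ, hν] at this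
  have hL0 : (0 : ℝ) < L := by exact_mod_cast hL
  set S := ∑ a ∈ Ico (0 : ℤ) L, u a ^ 2 with hS
  set D := ∑ a ∈ Ico (0 : ℤ) L, (if a + 1 < (L : ℤ) then (u (a + 1) - u a) ^ 2 else 0) with hD
  have key := h 0 μ (faceProfile u ν)
  rw [sum_profile hL hμν, sum_profile_sq hL hμν, gradSq_profile hL hμν, hu] at key
  simp only [Nat.add_sub_cancel, mul_zero, zero_pow two_ne_zero] at key
  rw [← hS, ← hD] at key
  -- clear the powers of L
  have e1 : ((L : ℝ)⁻¹) ^ (k + 2 + 1) * ((L : ℝ) ^ k * S) = S * ((L : ℝ)⁻¹) ^ 3 := by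
    rw [inv_pow, inv_pow]; field_simp; ring
  have e2 : ((L : ℝ)⁻¹) ^ (k + 2) * ((L : ℝ) ^ k * D) = ((L : ℝ) * D) * ((L : ℝ)⁻¹) ^ 3 := by
    rw [inv_pow, inv_pow]; field_simp; ring
  have key' : κ * (S * ((L : ℝ)⁻¹) ^ 3) ≤ ((L : ℝ) * D) * ((L : ℝ)⁻¹) ^ 3 := by
    have := key; rw [mul_assoc, e1, e2] at this; linarith
  have hinv : (0 : ℝ) < ((L : ℝ)⁻¹) ^ 3 := by positivity
  have := div_le_div_of_nonneg_right key' hinv.le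
  rwa [← mul_assoc, mul_div_assoc, mul_div_assoc, div_self hinv.ne', mul_one, mul_one] at this

/-- Quotient form: if moreover Σ u² > 0 then κ ≤ L · Σ(u(a+1) − u(a))² / Σ u(a)². [folklore] -/
theorem layerIneq_le_rayleigh (hd : 2 ≤ d) (hL : 1 ≤ L) (u : ℤ → ℝ) (hu : ∑ a ∈ Ico (0 : ℤ) L, u a = 0)
    (hS : 0 < ∑ a ∈ Ico (0 : ℤ) L, u a ^ 2) {κ : ℝ} (h : LayerIneq d L κ) :
    κ ≤ (L : ℝ) * (∑ a ∈ Ico (0 : ℤ) L, (if a + 1 < (L : ℤ) then (u (a + 1) - u a) ^ 2 else 0)) /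
      ∑ a ∈ Ico (0 : ℤ) L, u a ^ 2 := by
  rw [le_div_iff₀ hS]
  exact layerIneq_rayleigh hd hL u hu h

/-! ## §3  Integer witnesses -/

/-- Casting an integer profile `w : ℕ → ℤ` to a real profile on ℤ (zero extension irrelevant on [0, L)).
[folklore] -/
def castProfile (w : ℕ → ℤ) (a : ℤ) : ℝ := (w a.toNat : ℝ)

/-- Sums of an integer profile over the ℤ-interval [0, L) are sums over `range L`. [folklore] -/
theorem sum_castProfile (w : ℕ → ℤ) (F : ℤ → ℤ → ℝ) :
    ∑ a ∈ Ico (0 : ℤ) L, F a (w a.toNat) = ∑ i ∈ range L, F i (w i) := by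
  rw [sum_Ico_int_eq_sum_range L (fun a => F a (w a.toNat))]
  refine sum_congr rfl fun i _ => ?_
  simp only [Int.toNat_natCast]

/-- **An integer witness refutes the printed sentence in every dimension.**  If w : ℕ → ℤ has Σ_{i<L} w(i) = 0
and L · Σ_{i+1<L} (w(i+1) − w(i))² < Σ_{i<L} w(i)² (decidable integer facts), then `¬ LayerIneq d L 1` for
every d ≥ 2. [folklore] -/
theorem not_layerIneq_one_of_witness (hd : 2 ≤ d) (hL : 1 ≤ L) (w : ℕ → ℤ)
    (hw : ∑ i ∈ range L, w i = 0)
    (hlt : (L : ℤ) * ∑ i ∈ range L, (if i + 1 < L then (w (i + 1) - w i) ^ 2 else 0) <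
      ∑ i ∈ range L, w i ^ 2) :
    ¬ LayerIneq d L 1 := by
  intro h
  have hu : ∑ a ∈ Ico (0 : ℤ) L, castProfile w a = 0 := by
    unfold castProfile
    rw [sum_castProfile w (fun _ z => (z : ℝ))]
    exact_mod_cast hw
  have key := layerIneq_rayleigh hd hL (castProfile w) hu h
  rw [one_mul] at key
  -- identify both sides with the integer sums
  have hSq : ∑ a ∈ Ico (0 : ℤ) L, castProfile w a ^ 2 = ((∑ i ∈ range L, w i ^ 2 : ℤ) : ℝ) := by
    unfold castProfile
    rw [sum_castProfile w (fun _ z => (z : ℝ) ^ 2)]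
    push_cast; rfl
  have hDq : ∑ a ∈ Ico (0 : ℤ) L,
      (if a + 1 < (L : ℤ) then (castProfile w (a + 1) - castProfile w a) ^ 2 else 0) =
      ((∑ i ∈ range L, (if i + 1 < L then (w (i + 1) - w i) ^ 2 else 0) : ℤ) : ℝ) := by
    unfold castProfile
    rw [sum_Ico_int_eq_sum_range L]
    push_cast
    refine sum_congr rfl fun i _ => ?_
    have e1 : ((i : ℤ) + 1).toNat = i + 1 := by
      have : ((i : ℤ) + 1) = ((i + 1 : ℕ) : ℤ) := by push_cast; ring
      rw [this, Int.toNat_natCast]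
    simp only [Int.toNat_natCast, e1]
    by_cases hi : i + 1 < L
    · rw [if_pos (by exact_mod_cast hi), if_pos hi]
    · rw [if_neg (by exact_mod_cast hi), if_neg hi]
  rw [hSq, hDq] at key
  have : ((∑ i ∈ range L, w i ^ 2 : ℤ) : ℝ) ≤
      ((((L : ℤ) * ∑ i ∈ range L, (if i + 1 < L then (w (i + 1) - w i) ^ 2 else 0) : ℤ) : ℝ)) := by
    push_cast; push_cast at key; linarith
  exact absurd (by exact_mod_cast this) (not_le.2 hlt)

/-! ## §4  L = 10 (the witness of `B6.lean`) and L = 11 -/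

/-- The witness of `B6.lean`, read as a profile: w₁₀(i) = `B6.witnessL10[i]` = 1000·cos((i+½)π/10) rounded,
i = 0,…,9. [folklore] -/
def w10 (i : ℕ) : ℤ := B6.witnessL10.getD i 0

/-- Σ w₁₀ = 0 (`B6.witnessL10_sum` re-read). [folklore] -/
theorem w10_sum : ∑ i ∈ range 10, w10 i = 0 := by decide

/-- 10 · Σ(w₁₀(i+1) − w₁₀(i))² = 4895000 < 5000652 = Σ w₁₀(i)² (`B6.claim_p245_fails_L10` re-read). [folklore] -/
theorem w10_rayleigh :
    (10 : ℤ) * ∑ i ∈ range 10, (if i + 1 < 10 then (w10 (i + 1) - w10 i) ^ 2 else 0) <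
      ∑ i ∈ range 10, w10 i ^ 2 := by decide

/-- The two integer sums ARE the numbers of `B6.witnessL10_gradSq` / `B6.witnessL10_sumSq`
(489500 and 5000652), so `w10_rayleigh` is `B6.claim_p245_fails_L10` re-read. [folklore] -/
theorem w10_sums :
    ∑ i ∈ range 10, (if i + 1 < 10 then (w10 (i + 1) - w10 i) ^ 2 else 0) = B6.pathGradSq B6.witnessL10 ∧
      ∑ i ∈ range 10, w10 i ^ 2 = B6.sumSq B6.witnessL10 := by
  constructor <;> decide

/-- **The printed sentence fails for L = 10 in every dimension d ≥ 2** (B6's one-dimensional `decide` witness,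
transported to the layer by `layerIneq_rayleigh`). [folklore] -/
theorem not_layerIneq_one_ten (hd : 2 ≤ d) : ¬ LayerIneq d 10 1 :=
  not_layerIneq_one_of_witness hd (by norm_num) w10 w10_sum w10_rayleigh

/-- The L = 11 witness: 1000·cos((i+½)π/11) rounded, i = 0,…,10. [folklore] -/
def w11 (i : ℕ) : ℤ := ([990, 910, 756, 541, 282, 0, -282, -541, -756, -910, -990] : List ℤ).getD i 0

/-- Σ w₁₁ = 0. [folklore] -/
theorem w11_sum : ∑ i ∈ range 11, w11 i = 0 := by decide

/-- 11 · 445892 = 4904812 < 5503882 (ratio 0.8912; sharp value 44 sin²(π/22) = 0.89115…). [folklore] -/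
theorem w11_rayleigh :
    (11 : ℤ) * ∑ i ∈ range 11, (if i + 1 < 11 then (w11 (i + 1) - w11 i) ^ 2 else 0) <
      ∑ i ∈ range 11, w11 i ^ 2 := by decide

/-- **The printed sentence fails for L = 11 in every dimension d ≥ 2.** [folklore] -/
theorem not_layerIneq_one_eleven (hd : 2 ≤ d) : ¬ LayerIneq d 11 1 :=
  not_layerIneq_one_of_witness hd (by norm_num) w11 w11_sum w11_rayleigh

/-! ## §5  Every L ≥ 10 -/

/-- **Census claim G-B6-09, kernel-certified in full: the printed factor 1 of the p. 245 layer sentence fails for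
EVERY L ≥ 10 and every d ≥ 2** (L = 10, 11 by the cosine witnesses above, L ≥ 12 by the linear test function of
`B6LayerUpperBound.not_layerIneq_one`). [folklore] -/
theorem not_layerIneq_one_of_ten_le (hd : 2 ≤ d) (hL : 10 ≤ L) : ¬ LayerIneq d L 1 := by
  rcases (by omega : L = 10 ∨ L = 11 ∨ 12 ≤ L) with rfl | rfl | h12
  · exact not_layerIneq_one_ten hd
  · exact not_layerIneq_one_eleven hd
  · exact not_layerIneq_one hd h12

/-- … hence it fails for every κ ≥ 1 as well (`LayerIneq.mono`). [folklore] -/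
theorem not_layerIneq_of_one_le (hd : 2 ≤ d) (hL : 10 ≤ L) {κ : ℝ} (hκ : 1 ≤ κ) : ¬ LayerIneq d L κ :=
  fun h => not_layerIneq_one_of_ten_le hd hL (h.mono hκ)

end Literature.MathematicalPhysics.QuantumFieldTheory.Balaban1983to89.B6LayerRayleigh
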